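import Summits.CriticalPhenomena.SAWScalingLimit.Theorems.SimpleSubseqLimits.Negative.SimpleSubseqLimitsSimpleNotClosed
import Literature.Probability.Percolation.CanonicalDiscretisationTies

/-!
# Negative-side results for the crux `SAWLoopFugacityFlow.SimpleSubseqLimits` (stmt-CriticalPhenomena-4982):
RANGE-BLINDNESS — the simplicity clause is load-bearing downstream and invisible to every range
functional (work-file §7).

The crux delivers exactly the carrier clause consumed by the shared support `AvoidanceDeterminesLaw`
(stmt-CriticalPhenomena-1373). Here: (i) two curve classes with the SAME range, source and target, one
simple and one not — the diameter of the unit disc traversed once (`diam : t ↦ 1 - 2t`) and with a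
Z-fold (`zig : 1 → -1/3 → 1/3 → -1`, not flat, hence not simple by the tree's description of simple
classes) — so no functional of `(range, source, target)`, in particular no family of avoidance events
`rangeSubset S`, can certify simplicity; (ii) consequently `AvoidanceDeterminesLaw` with the clause
`γ ∈ CurveClass.simple` dropped from its carrier hypotheses is FALSE: the Dirac masses at `mk diam` and
`mk zig` are carried by chords from `1` to `-1` in the closed disc meeting the circle only at `±1`, give
the same mass to every avoidance event, and differ. The decomposition "`SimpleSubseqLimits` (order of
traversal) + `AvoidanceDeterminesLaw` (range data)" cannot be relaxed on the simplicity side.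

Refuter `cdisprove` (standing adversary); the full indexed work file is
`Summits/CriticalPhenomena/SAWScalingLimit/Cruxes/SimpleSubseqLimits/Disproof.lean`.
-/

noncomputable section

open MeasureTheory Filter Topology Set Metric
open Literature.Probability.RandomPlanarGeometry
open scoped ENNReal NNReal

namespace Summit.CriticalPhenomena.SAWScalingLimit.Theorems.SimpleSubseqLimits.Negative

/-! ## The diameter, once and with a Z-fold -/

/-- The diameter of the unit disc from `1` to `-1`, traversed once: `t ↦ 1 - 2t`. [folklore] -/
def diam : Curve ℂ := ⟨⟨fun t => ((1 - 2 * (t : ℝ) : ℝ) : ℂ), by fun_prop⟩⟩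

/-- Pointwise formula for `diam`. [folklore] -/
@[simp] theorem diam_apply (t : unitInterval) : diam t = ((1 - 2 * (t : ℝ) : ℝ) : ℂ) := rfl

/-- The zigzag profile `1 → -1/3 → 1/3 → -1`: `max (1 - 4t) (min (2t - 1) (3 - 4t))`. [folklore] -/
def zigFun (t : ℝ) : ℝ := max (1 - 4 * t) (min (2 * t - 1) (3 - 4 * t))

/-- `zigFun` is continuous. [folklore] -/
theorem continuous_zigFun : Continuous zigFun := by unfold zigFun; fun_prop

/-- The diameter traversed with a Z-fold `1 → -1/3 → 1/3 → -1` (its middle third is covered three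
times): same range and endpoints as `diam`, not flat. [folklore] -/
def zig : Curve ℂ := ⟨⟨fun t => ((zigFun t : ℝ) : ℂ), by have := continuous_zigFun; fun_prop⟩⟩

/-- Pointwise formula for `zig`. [folklore] -/
@[simp] theorem zig_apply (t : unitInterval) : zig t = ((zigFun t : ℝ) : ℂ) := rfl

/-- `diam` is injective. [folklore] -/
theorem diam_isSimple : diam.IsSimple := by
  intro t t' h
  have := Complex.ofReal_inj.1 h
  exact Subtype.ext (by linarith)

/-- `zigFun` takes values in `[-1, 1]` on `[0, 1]`. [folklore] -/
theorem zigFun_mem_Icc (t : unitInterval) : zigFun t ∈ Icc (-1 : ℝ) 1 := by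
  obtain ⟨h0, h1⟩ := t.2
  simp only [zigFun, mem_Icc, le_max_iff, max_le_iff, le_min_iff, min_le_iff]
  constructor
  · by_cases h : (t : ℝ) ≤ 1 / 2
    · left; linarith
    · right; constructor <;> linarith
  · refine ⟨by linarith, ?_⟩
    by_cases h : (t : ℝ) ≤ 2 / 3
    · left; linarith
    · right; linarith

/-- `zig` and `diam` have the same range (the real segment `[-1, 1]`). [folklore] -/
theorem range_zig_eq_range_diam : zig.range = diam.range := by
  apply Subset.antisymm
  · rintro _ ⟨t, rfl⟩
    obtain ⟨hlo, hhi⟩ := zigFun_mem_Icc t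
    refine ⟨⟨(1 - zigFun t) / 2, by constructor <;> linarith⟩, ?_⟩
    simp only [diam_apply, zig_apply, Complex.ofReal_inj]
    ring
  · rintro _ ⟨t, rfl⟩
    obtain ⟨h0, h1⟩ := t.2
    by_cases hy : (1 : ℝ) / 3 ≤ (t : ℝ) * 2 / 2 + 1 / 3 ∧ (2 : ℝ) / 3 ≤ t
    · -- hit `1 - 2t ≤ -1/3` on the last piece `3 - 4u`, `u = (1 + t)/2 ∈ [2/3, 1]`
      refine ⟨⟨(1 + (t : ℝ)) / 2, by constructor <;> linarith⟩, ?_⟩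
      simp only [diam_apply, zig_apply, Complex.ofReal_inj, zigFun]
      rw [max_eq_right, min_eq_right] <;>
        [ring; linarith; (rw [min_eq_right] <;> linarith)]
    · by_cases ht : (t : ℝ) ≤ 2 / 3
      · -- hit `1 - 2t ≥ -1/3` on the first piece `1 - 4u`, `u = t/2 ∈ [0, 1/3]`
        refine ⟨⟨(t : ℝ) / 2, by constructor <;> linarith⟩, ?_⟩
        simp only [diam_apply, zig_apply, Complex.ofReal_inj, zigFun]
        rw [max_eq_left]
        · ring
        · exact (min_le_left _ _).trans (by linarith)
      · exact absurd ⟨by linarith, by linarith⟩ hy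

/-- `zig` is not flat: `zig (1/6) = zig (2/3) = 1/3` while `zig (1/3) = -1/3`. [folklore] -/
theorem zig_not_isFlat : ¬ zig.IsFlat := by
  intro h
  have hs : ((1 : ℝ) / 6) ∈ unitInterval := ⟨by norm_num, by norm_num⟩
  have hu : ((1 : ℝ) / 3) ∈ unitInterval := ⟨by norm_num, by norm_num⟩
  have ht : ((2 : ℝ) / 3) ∈ unitInterval := ⟨by norm_num, by norm_num⟩
  have key := h ⟨_, hs⟩ ⟨_, hu⟩ ⟨_, ht⟩ (Subtype.mk_le_mk.2 (by norm_num))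
    (Subtype.mk_le_mk.2 (by norm_num))
  simp only [zig_apply, zigFun, Complex.ofReal_inj] at key
  norm_num at key

/-- The class of `zig` is not simple (its representatives would be flat). [folklore] -/
theorem mk_zig_not_mem_simple : CurveClass.mk zig ∉ CurveClass.simple := fun h =>
  zig_not_isFlat (isFlat_of_mk_mem_simple h)

/-- The class of `diam` is simple. [folklore] -/
theorem mk_diam_mem_simple : CurveClass.mk diam ∈ CurveClass.simple :=
  CurveClass.mk_mem_simple diam_isSimple

/-- The two classes differ. [folklore] -/
theorem mk_diam_ne_mk_zig : CurveClass.mk diam ≠ CurveClass.mk zig := fun h =>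
  mk_zig_not_mem_simple (h ▸ mk_diam_mem_simple)

/-- **RANGE DATA ARE BLIND TO SIMPLICITY.** Two curve classes with the same range, the same
source and the same target, one simple and the other not: no functional of
`(range, source, target)` — in particular no family of avoidance events `rangeSubset S` — can
certify the simplicity clause of the crux. [folklore] -/
theorem exists_simple_and_not_simple_same_range :
    ∃ c c' : CurveClass ℂ, c ∈ CurveClass.simple ∧ c' ∉ CurveClass.simple ∧
      c.range = c'.range ∧ c.source = c'.source ∧ c.target = c'.target := by
  refine ⟨CurveClass.mk diam, CurveClass.mk zig, mk_diam_mem_simple, mk_zig_not_mem_simple,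
    ?_, ?_, ?_⟩
  · rw [CurveClass.range_mk, CurveClass.range_mk, range_zig_eq_range_diam]
  · simp only [CurveClass.source_mk, Curve.source_def, diam_apply, zig_apply, zigFun]
    norm_num
  · simp only [CurveClass.target_mk, Curve.target_def, diam_apply, zig_apply, zigFun]
    norm_num

/-! ## The consumer `AvoidanceDeterminesLaw` needs the simplicity clause -/

-- `DobrushinDomain.unitDisc.pt 0 = 1` is `Literature.Probability.Percolation.unitDisc_pt_zero`
-- (CanonicalDiscretisationTies.lean); the companion for `pt 1` below DUPLICATES the Summits helper
-- `Summit.CriticalPhenomena.SAWScalingLimit.Cruxes.HexConjecture.Negative.unitDisc_pt_one`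
-- (Theorems/HexConjecture/Negative/LoadBearing.lean, heavy hexagonal import closure) — kept local;
-- a librarian may lift it to Literature next to `unitDisc_pt_zero`.
/-- The second marked point of the unit-disc Dobrushin domain is `-1` (duplicate of
`…Cruxes.HexConjecture.Negative.unitDisc_pt_one`, see the comment above). [folklore] -/
theorem unitDisc_pt_one : DobrushinDomain.unitDisc.pt 1 = -1 := by
  simp [MarkedDomain.pt, DobrushinDomain.unitDisc, JordanDomain.unitDisc, circleMap]
  rw [show (2 * (Real.pi : ℂ) * 2⁻¹ * Complex.I) = Real.pi * Complex.I by ring]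
  exact Complex.exp_pi_mul_I

/-- The diameter is a chord of the unit disc: its range lies in the closed disc and meets the unit
circle only at `±1`. [folklore] -/
theorem diam_chord : diam.range ⊆ closure (Metric.ball (0 : ℂ) 1) ∧
    diam.range ∩ frontier (Metric.ball (0 : ℂ) 1) ⊆ {(1 : ℂ), -1} := by
  rw [closure_ball _ one_ne_zero, frontier_ball _ one_ne_zero]
  constructor
  · rintro _ ⟨t, rfl⟩
    obtain ⟨h0, h1⟩ := t.2
    rw [diam_apply, Metric.mem_closedBall, dist_zero_right, Complex.norm_real, Real.norm_eq_abs,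
      abs_le]
    constructor <;> linarith
  · rintro _ ⟨⟨t, rfl⟩, hx⟩
    obtain ⟨h0, h1⟩ := t.2
    rw [Metric.mem_sphere, dist_zero_right, diam_apply, Complex.norm_real, Real.norm_eq_abs] at hx
    simp only [diam_apply, mem_insert_iff, mem_singleton_iff]
    rcases (abs_eq zero_le_one).1 hx with h | h
    · left; rw [h]; simp
    · right; rw [h]; simp

/-- `AvoidanceDeterminesLaw` (shared support stmt-CriticalPhenomena-1373) with the simplicity clause
`γ ∈ CurveClass.simple` DROPPED from both carrier hypotheses, everything else verbatim — a
deliberately FALSE weakening, refuted below (not a literature fact). -/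
def AvoidanceDeterminesLawWithoutSimple : Prop :=
  ∀ (D : DobrushinDomain) (μ ν : Measure (CurveClass ℂ)), IsProbabilityMeasure μ →
    IsProbabilityMeasure ν →
    (∀ᵐ γ ∂μ, γ.source = D.pt 0 ∧ γ.target = D.pt 1 ∧ γ.range ⊆ closure D.carrier ∧
      γ.range ∩ frontier D.carrier ⊆ {D.pt 0, D.pt 1}) →
    (∀ᵐ γ ∂ν, γ.source = D.pt 0 ∧ γ.target = D.pt 1 ∧ γ.range ⊆ closure D.carrier ∧
      γ.range ∩ frontier D.carrier ⊆ {D.pt 0, D.pt 1}) →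
    (∀ D' : DobrushinDomain, D'.carrier ⊆ D.carrier → D'.pt 0 = D.pt 0 → D'.pt 1 = D.pt 1 →
      (∃ ε : ℝ, 0 < ε ∧ D'.carrier ∩ Metric.ball (D.pt 0) ε = D.carrier ∩ Metric.ball (D.pt 0) ε ∧
        D'.carrier ∩ Metric.ball (D.pt 1) ε = D.carrier ∩ Metric.ball (D.pt 1) ε) →
      μ (CurveClass.rangeSubset (closure D'.carrier)) =
        ν (CurveClass.rangeSubset (closure D'.carrier))) →
    μ = ν

/-- **The simplicity clause delivered by the crux is exactly what its consumer needs**: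
`AvoidanceDeterminesLaw` WITHOUT `γ ∈ simple` in the carrier is FALSE — the Dirac masses at `mk diam`
(simple) and `mk zig` (not simple) are carried by chords from `1` to `-1` in the closed unit disc
meeting the circle only at `±1`, give the SAME mass to every avoidance event `rangeSubset S` (equal
ranges), and differ. The order of traversal is invisible to avoidance data. [folklore] -/
theorem avoidanceDeterminesLaw_false_without_simple : ¬ AvoidanceDeterminesLawWithoutSimple := by
  intro h
  have hcar : ∀ c : Curve ℂ, c.range = diam.range → c 0 = 1 → c 1 = -1 →
      ∀ᵐ γ ∂(Measure.dirac (CurveClass.mk c)), γ.source = DobrushinDomain.unitDisc.pt 0 ∧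
        γ.target = DobrushinDomain.unitDisc.pt 1 ∧
        γ.range ⊆ closure DobrushinDomain.unitDisc.carrier ∧
        γ.range ∩ frontier DobrushinDomain.unitDisc.carrier ⊆
          {DobrushinDomain.unitDisc.pt 0, DobrushinDomain.unitDisc.pt 1} := by
    intro c hc h0 h1
    rw [ae_dirac_eq, eventually_pure, Literature.Probability.Percolation.unitDisc_pt_zero,
      unitDisc_pt_one, CurveClass.source_mk,
      CurveClass.target_mk, CurveClass.range_mk, hc]
    exact ⟨h0, h1, diam_chord⟩
  have hμ := hcar diam rfl (by simp) (by simp; norm_num)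
  have hν := hcar zig range_zig_eq_range_diam (by simp [zigFun]) (by simp [zigFun]; norm_num)
  have heq := h DobrushinDomain.unitDisc (Measure.dirac (CurveClass.mk diam))
    (Measure.dirac (CurveClass.mk zig)) inferInstance inferInstance hμ hν ?_
  · have h1 : (Measure.dirac (CurveClass.mk diam)) {CurveClass.mk diam} =
        (Measure.dirac (CurveClass.mk zig)) {CurveClass.mk diam} := by rw [heq]
    rw [Measure.dirac_apply_of_mem (mem_singleton _),
      Measure.dirac_apply' _ (measurableSet_singleton _),
      indicator_of_notMem (fun h => mk_diam_ne_mk_zig (mem_singleton_iff.1 h).symm)] at h1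
    exact one_ne_zero h1
  · intro D' _ _ _ _
    have hm := CurveClass.measurableSet_rangeSubset (E := ℂ) (S := closure D'.carrier)
      isClosed_closure
    have hiff : CurveClass.mk diam ∈ CurveClass.rangeSubset (closure D'.carrier) ↔
        CurveClass.mk zig ∈ CurveClass.rangeSubset (closure D'.carrier) := by
      simp only [CurveClass.mem_rangeSubset, CurveClass.range_mk, range_zig_eq_range_diam]
    rw [Measure.dirac_apply' _ hm, Measure.dirac_apply' _ hm]
    by_cases hmem : CurveClass.mk diam ∈ CurveClass.rangeSubset (closure D'.carrier)
    · rw [indicator_of_mem hmem, indicator_of_mem (hiff.1 hmem)]; rfl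
    · rw [indicator_of_notMem hmem, indicator_of_notMem (fun h => hmem (hiff.2 h))]

end Summit.CriticalPhenomena.SAWScalingLimit.Theorems.SimpleSubseqLimits.Negative
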